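import Summits.AtomisticToContinuum.Crystallization.Theorems.ThreeConeCertificateExactCertificateFieldInvisible
import Summits.AtomisticToContinuum.Crystallization.Theorems.ThreeConeCertificateExactCertificateNoGapNecessary

/-!
# `ExactCertificate` (stmt-AtomisticToContinuum-11959): lattice periodisation of a positive-type
# radial kernel, III — neutrality bounds for a MOVING template

Line `closure-makes-nogap-exact`, registered stub `stub_templateNeutrality` (no witness assumed).
Let `Q = F + G` be ANY periodic configuration of `ℝ³`, `ρ₀ ∈ ℝ`, and `f : ℝ → ℝ` a radial kernel of
positive type on `ℝ³` (all finite Gram forms `Σᵢⱼ wᵢ wⱼ f(dist yᵢ yⱼ) ≥ 0`) with `f ≤ V_LJ` on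
`[ρ₀, ∞) ∩ (0, ∞)`.  Then the per-particle `Q`-sum of `f` INCLUDING the self term,
`f 0 + 2 e_Q(f)`, satisfies

* `0 ≤ f 0 + 2 e_Q(f)` (`template_neutrality_nonneg`): `f` is non-positive on `[max ρ₀ 1, ∞)`
  (`f ≤ V_LJ ≤ 0` there), so every coset family of `f` is summable (part 0, `summable_coset`),
  the site sums are fields minus the self term (part II, `siteSum_eq_field_sub`), whence
  `#F · (f 0 + 2 e_Q(f)) = Σ_{x, x' ∈ F} S(x − x')` with `S` the lattice periodisation of `f`
  (`template_sum_motif_field_eq`), and the right-hand side is a Gram form of `S` with unit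
  weights on the motif, `≥ 0` by part I (`periodisation_posType`);
* `f 0 + 2 e_Q(f) ≤ f 0 + 2 e_Q(f·1_{(−∞,ρ₀)}) + 2 e_Q(V_LJ·1_{[ρ₀,∞)})` — the TAIL SLACK of
  `stub_noGap` (`template_neutrality_le`): the site families of `f` are summable (restriction of
  the field `Σ_{y ∈ Q} f(dist x y)`, `field_hasSum`), the core truncation has finite support, so
  `e_Q(f) = e_Q(f·1_{<ρ₀}) + e_Q(f·1_{≥ρ₀})` (`template_energyPerParticle_split`), and
  `e_Q(f·1_{≥ρ₀}) ≤ e_Q(V_LJ·1_{≥ρ₀})` termwise, since all distances in a site family are `> 0`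
  (`template_energyPerParticle_tail_le`).

No new definitions; all `[folklore]`.
-/

noncomputable section

namespace Summit.AtomisticToContinuum.Crystallization.Theorems.ThreeConeCertificateExactCertificate.Field

open Literature.MathematicalPhysics.StatisticalMechanics
open Summit.AtomisticToContinuum.Crystallization.Theorems.ChargedEnergyGapNegative (E3)
open Summit.AtomisticToContinuum.Crystallization.Theorems.ChargedEnergyGapNegative.Blocks
  (latVec siteSum sum_siteSum_eq)
open scoped BigOperators

/-! ## Eventual non-positivity -/

/-- A kernel lying below `V_LJ` on `[ρ₀,∞) ∩ (0,∞)` is non-positive on `[max ρ₀ 1, ∞)`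
(`V_LJ ≤ 0` on `[1,∞)`). [folklore] -/
theorem template_nonpos_of_le_tail {f : ℝ → ℝ} {ρ₀ : ℝ}
    (htail : ∀ r : ℝ, ρ₀ ≤ r → 0 < r → f r ≤ lennardJones r) :
    ∀ r : ℝ, max ρ₀ 1 ≤ r → f r ≤ 0 := fun r hr =>
  (htail r ((le_max_left _ _).trans hr) (one_pos.trans_le ((le_max_right _ _).trans hr))).trans
    (lennardJones_nonpos ((le_max_right _ _).trans hr))

/-! ## The lower bound: Bochner on the lattice periodisation -/

section LowerBound

variable (Q : PeriodicConfiguration 3) {f : ℝ → ℝ}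

/-- **The motif double sum of the periodisation is `#F · (f 0 + 2 e_Q(f))`**:
`Σ_{x ∈ F} Σ_{x' ∈ F} Σ_d f(dist (x − x') (latVec d)) = Σ_{x ∈ F} (siteSum f x + f 0)`, provided
the coset families converge. [folklore] -/
theorem template_sum_motif_field_eq
    (hs : ∀ v : E3, Summable fun d : Fin 3 → ℤ => f (dist v (latVec Q d))) :
    ∑ x ∈ Q.motif, ∑ x' ∈ Q.motif, ∑' d : Fin 3 → ℤ, f (dist (x - x') (latVec Q d)) =
      Q.motif.card * (f 0 + 2 * Q.energyPerParticle f) := by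
  have h1 : ∀ x ∈ Q.motif, ∑ x' ∈ Q.motif, ∑' d : Fin 3 → ℤ, f (dist (x - x') (latVec Q d)) =
      siteSum Q f x + f 0 := fun x hx => by
    rw [siteSum_eq_field_sub Q f hs hx, sub_add_cancel]
  rw [Finset.sum_congr rfl h1, Finset.sum_add_distrib, sum_siteSum_eq, Finset.sum_const,
    nsmul_eq_mul]
  ring

variable (hpd : ∀ (n : ℕ) (y : Fin n → E3) (w : Fin n → ℝ),
  0 ≤ ∑ i, ∑ j, w i * w j * f (dist (y i) (y j)))
include hpd

/-- **The motif double sum of the periodisation of a positive-type kernel is `≥ 0`**: it is the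
Gram form of the periodisation at the motif points with unit weights. [folklore] -/
theorem template_sum_motif_field_nonneg
    (hs : ∀ v : E3, Summable fun d : Fin 3 → ℤ => f (dist v (latVec Q d))) :
    0 ≤ ∑ x ∈ Q.motif, ∑ x' ∈ Q.motif, ∑' d : Fin 3 → ℤ, f (dist (x - x') (latVec Q d)) := by
  have hsum : ∀ g : E3 → ℝ, ∑ i, g (Q.motif.equivFin.symm i) = ∑ x ∈ Q.motif, g x := fun g => by
    rw [← Finset.sum_coe_sort Q.motif]
    exact Q.motif.equivFin.symm.sum_comp (fun x : Q.motif => g x)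
  have key := periodisation_posType Q f hpd hs Q.motif.card
    (fun i => (Q.motif.equivFin.symm i : E3)) (fun _ => 1)
  simp only [one_mul] at key
  rw [← hsum fun x => ∑ x' ∈ Q.motif, ∑' d : Fin 3 → ℤ, f (dist (x - x') (latVec Q d))]
  exact key.trans_eq (Finset.sum_congr rfl fun i _ =>
    hsum fun x' => ∑' d : Fin 3 → ℤ, f (dist ((Q.motif.equivFin.symm i : E3) - x') (latVec Q d)))

/-- **Lower neutrality bound.** For a positive-type radial `f` on `ℝ³` that is eventually
non-positive, `0 ≤ f 0 + 2 e_Q(f)` on EVERY periodic configuration `Q`. [folklore] -/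
theorem template_neutrality_nonneg {R : ℝ} (hR : ∀ r : ℝ, R ≤ r → f r ≤ 0) :
    0 ≤ f 0 + 2 * Q.energyPerParticle f := by
  have hs : ∀ v : E3, Summable fun d : Fin 3 → ℤ => f (dist v (latVec Q d)) :=
    summable_coset Q hpd hR
  have hF : (0 : ℝ) < Q.motif.card := by exact_mod_cast Q.motif_nonempty.card_pos
  have h := template_sum_motif_field_nonneg Q hpd hs
  rw [template_sum_motif_field_eq Q hs] at h
  exact nonneg_of_mul_nonneg_right h hF

end LowerBound

/-! ## The upper bound: `f ≤ V_LJ` termwise on the tail -/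

section UpperBound

variable (Q : PeriodicConfiguration 3) {f : ℝ → ℝ}

/-- **The site families of `f` are summable** at every point of space, provided the coset
families converge (restriction of the field family `y ↦ f(dist x y)` on the point set along the
injection `{y ∈ Q, y ≠ x} → Q`). [folklore] -/
theorem template_summable_site
    (hs : ∀ v : E3, Summable fun d : Fin 3 → ℤ => f (dist v (latVec Q d))) (x : E3) :
    Summable fun q : {q : E3 // q ∈ Q.points ∧ q ≠ x} => f (dist x q.1) := by
  have hι : Function.Injective
      (fun q : {q : E3 // q ∈ Q.points ∧ q ≠ x} => (⟨q.1, q.2.1⟩ : Q.points)) :=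
    fun q q' h => by
    have h' := congrArg Subtype.val h
    exact Subtype.ext h'
  exact ((field_hasSum Q f hs x).summable.comp_injective hι).congr fun _ => rfl

/-- **Core/tail splitting of the energy per particle**: if the site families of `f` at the motif
points are summable, then `e_Q(f) = e_Q(f·1_{(−∞,ρ₀)}) + e_Q(f·1_{[ρ₀,∞)})` (the core truncation
has finite support). [folklore] -/
theorem template_energyPerParticle_split (ρ₀ : ℝ)
    (hsf : ∀ x ∈ Q.motif, Summable fun q : {q : E3 // q ∈ Q.points ∧ q ≠ x} => f (dist x q.1)) :
    Q.energyPerParticle f = Q.energyPerParticle (fun r => if r < ρ₀ then f r else 0) +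
      Q.energyPerParticle (fun r => if r < ρ₀ then 0 else f r) := by
  have h₁ : ∀ x ∈ Q.motif, Summable fun q : {y : E3 // y ∈ Q.points ∧ y ≠ x} =>
      (if dist x q.1 < ρ₀ then f (dist x q.1) else 0) := fun x _ =>
    Slackness.summable_core Q ρ₀ f x
  have h₂ : ∀ x ∈ Q.motif, Summable fun q : {y : E3 // y ∈ Q.points ∧ y ≠ x} =>
      (if dist x q.1 < ρ₀ then 0 else f (dist x q.1)) := fun x hx => by
    refine ((hsf x hx).sub (h₁ x hx)).congr fun q => ?_
    show f (dist x q.1) - (if dist x q.1 < ρ₀ then f (dist x q.1) else 0) =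
      (if dist x q.1 < ρ₀ then 0 else f (dist x q.1))
    split_ifs <;> simp
  have hadd := Slackness.energyPerParticle_add Q (W₁ := fun r => if r < ρ₀ then f r else 0)
    (W₂ := fun r => if r < ρ₀ then 0 else f r) h₁ h₂
  rw [← hadd]
  congr 1
  funext r
  show f r = (if r < ρ₀ then f r else 0) + (if r < ρ₀ then 0 else f r)
  split_ifs <;> simp

/-- **Termwise tail comparison**: if `f ≤ V_LJ` on `[ρ₀,∞) ∩ (0,∞)` and the site families of `f`
at the motif points are summable, then `e_Q(f·1_{[ρ₀,∞)}) ≤ e_Q(V_LJ·1_{[ρ₀,∞)})` (all distances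
in a site family are `> 0`; both tail families are summable as differences of summable families
and finitely supported core truncations). [folklore] -/
theorem template_energyPerParticle_tail_le {ρ₀ : ℝ}
    (htail : ∀ r : ℝ, ρ₀ ≤ r → 0 < r → f r ≤ lennardJones r)
    (hsf : ∀ x ∈ Q.motif, Summable fun q : {q : E3 // q ∈ Q.points ∧ q ≠ x} => f (dist x q.1)) :
    Q.energyPerParticle (fun r => if r < ρ₀ then 0 else f r) ≤
      Q.energyPerParticle (fun r => if r < ρ₀ then 0 else lennardJones r) := by
  unfold PeriodicConfiguration.energyPerParticle
  have hF : (0 : ℝ) ≤ (2 * (Q.motif.card : ℝ))⁻¹ := by positivity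
  refine mul_le_mul_of_nonneg_left (Finset.sum_le_sum fun x hx => ?_) hF
  have h1 : Summable fun q : {q : E3 // q ∈ Q.points ∧ q ≠ x} =>
      (if dist x q.1 < ρ₀ then 0 else f (dist x q.1)) := by
    refine ((hsf x hx).sub (Slackness.summable_core Q ρ₀ f x)).congr fun q => ?_
    show f (dist x q.1) - (if dist x q.1 < ρ₀ then f (dist x q.1) else 0) =
      (if dist x q.1 < ρ₀ then 0 else f (dist x q.1))
    split_ifs <;> simp
  have h2 : Summable fun q : {q : E3 // q ∈ Q.points ∧ q ≠ x} =>
      (if dist x q.1 < ρ₀ then 0 else lennardJones (dist x q.1)) := by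
    refine ((Q.summable_lennardJones_dist_three x).sub
      (Slackness.summable_core Q ρ₀ lennardJones x)).congr fun q => ?_
    show lennardJones (dist x q.1) - (if dist x q.1 < ρ₀ then lennardJones (dist x q.1) else 0) =
      (if dist x q.1 < ρ₀ then 0 else lennardJones (dist x q.1))
    split_ifs <;> simp
  refine h1.tsum_le_tsum (fun q => ?_) h2
  show (if dist x q.1 < ρ₀ then 0 else f (dist x q.1)) ≤
    (if dist x q.1 < ρ₀ then 0 else lennardJones (dist x q.1))
  split_ifs with hlt
  · exact le_rfl
  · exact htail _ (not_lt.1 hlt) (dist_pos.2 fun heq => q.2.2 heq.symm)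

variable (hpd : ∀ (n : ℕ) (y : Fin n → E3) (w : Fin n → ℝ),
  0 ≤ ∑ i, ∑ j, w i * w j * f (dist (y i) (y j)))
include hpd

/-- **Upper neutrality bound (the tail slack dominates).** For a positive-type radial `f` on `ℝ³`
with `f ≤ V_LJ` on `[ρ₀,∞) ∩ (0,∞)` and every periodic `Q`:
`f 0 + 2 e_Q(f) ≤ f 0 + 2 e_Q(f·1_{(−∞,ρ₀)}) + 2 e_Q(V_LJ·1_{[ρ₀,∞)})`. [folklore] -/
theorem template_neutrality_le {ρ₀ : ℝ}
    (htail : ∀ r : ℝ, ρ₀ ≤ r → 0 < r → f r ≤ lennardJones r) :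
    f 0 + 2 * Q.energyPerParticle f ≤
      f 0 + 2 * Q.energyPerParticle (fun r => if r < ρ₀ then f r else 0) +
        2 * Q.energyPerParticle (fun r => if r < ρ₀ then 0 else lennardJones r) := by
  have hs : ∀ v : E3, Summable fun d : Fin 3 → ℤ => f (dist v (latVec Q d)) :=
    summable_coset Q hpd (template_nonpos_of_le_tail htail)
  have hsf : ∀ x ∈ Q.motif, Summable fun q : {q : E3 // q ∈ Q.points ∧ q ≠ x} =>
      f (dist x q.1) := fun x _ => template_summable_site Q hs x
  rw [template_energyPerParticle_split Q ρ₀ hsf]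
  have h := template_energyPerParticle_tail_le Q htail hsf
  linarith

/-- **Two-sided neutrality bounds for a moving template**:
`0 ≤ f 0 + 2 e_Q(f) ≤ f 0 + 2 e_Q(f·1_{(−∞,ρ₀)}) + 2 e_Q(V_LJ·1_{[ρ₀,∞)})`. [folklore] -/
theorem template_neutrality {ρ₀ : ℝ}
    (htail : ∀ r : ℝ, ρ₀ ≤ r → 0 < r → f r ≤ lennardJones r) :
    0 ≤ f 0 + 2 * Q.energyPerParticle f ∧
      f 0 + 2 * Q.energyPerParticle f ≤
        f 0 + 2 * Q.energyPerParticle (fun r => if r < ρ₀ then f r else 0) +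
          2 * Q.energyPerParticle (fun r => if r < ρ₀ then 0 else lennardJones r) :=
  ⟨template_neutrality_nonneg Q hpd (template_nonpos_of_le_tail htail),
    template_neutrality_le Q hpd htail⟩

/-- **The field of a moving template is controlled by its tail slack** (approximate
invisibility, cf. `field_sq_le`): for every `w ∈ ℝ³`,
`T(w)² ≤ S(0) · #F · (f 0 + 2 e_Q(f·1_{(−∞,ρ₀)}) + 2 e_Q(V_LJ·1_{[ρ₀,∞)}))`, where
`T(w) = Σ_{x ∈ F} S(w − x)` is the `f`-field of the crystal at `w` and
`S(0) = Σ_d f(|latVec d|) ≥ 0`; so a template with tail slack `≤ δ` has field `O(√δ)` uniformly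
in space. [folklore] -/
theorem template_field_sq_le {ρ₀ : ℝ}
    (htail : ∀ r : ℝ, ρ₀ ≤ r → 0 < r → f r ≤ lennardJones r) (w : E3) :
    (∑ x ∈ Q.motif, ∑' d : Fin 3 → ℤ, f (dist (w - x) (latVec Q d))) ^ 2 ≤
      (∑' d : Fin 3 → ℤ, f (dist (0 : E3) (latVec Q d))) *
        (Q.motif.card * (f 0 + 2 * Q.energyPerParticle (fun r => if r < ρ₀ then f r else 0) +
          2 * Q.energyPerParticle (fun r => if r < ρ₀ then 0 else lennardJones r))) := by
  have hs : ∀ v : E3, Summable fun d : Fin 3 → ℤ => f (dist v (latVec Q d)) :=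
    summable_coset Q hpd (template_nonpos_of_le_tail htail)
  have hA := periodisation_posType Q f hpd hs
  have h0 : 0 ≤ ∑' d : Fin 3 → ℤ, f (dist (0 : E3) (latVec Q d)) := by
    simpa using hA 1 (fun _ => 0) (fun _ => 1)
  have hF : (0 : ℝ) ≤ Q.motif.card := Nat.cast_nonneg _
  refine (field_sq_le Q f hs hA w).trans (mul_le_mul_of_nonneg_left ?_ h0)
  exact mul_le_mul_of_nonneg_left (template_neutrality_le Q hpd htail) hF

end UpperBound

/-! ## The registered stub -/

/-- **Registered stub `stub_templateNeutrality` of crux item stmt-AtomisticToContinuum-11959**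
(line `closure-makes-nogap-exact`; signature verbatim) — MOVING TEMPLATE, no witness assumed:
for every periodic `Q` and radial positive-type `f` with `f ≤ V_LJ` beyond `ρ₀`,
`0 ≤ f 0 + 2e_Q(f) ≤ f 0 + 2e_Q(f·1_{(0,ρ₀)}) + 2e_Q(V_LJ·1_{[ρ₀,∞)})` (the tail slack of
`stub_noGap`) = `template_neutrality`. [folklore] -/
theorem stub_templateNeutrality : ∀ (Q : PeriodicConfiguration 3) (ρ₀ : ℝ) (f : ℝ → ℝ),
    (∀ (n : ℕ) (y : Fin n → EuclideanSpace ℝ (Fin 3)) (w : Fin n → ℝ),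
      0 ≤ ∑ i, ∑ j, w i * w j * f (dist (y i) (y j))) →
    (∀ r : ℝ, ρ₀ ≤ r → 0 < r → f r ≤ lennardJones r) →
    0 ≤ f 0 + 2 * Q.energyPerParticle f ∧
      f 0 + 2 * Q.energyPerParticle f ≤
        f 0 + 2 * Q.energyPerParticle (fun r => if r < ρ₀ then f r else 0) +
          2 * Q.energyPerParticle (fun r => if r < ρ₀ then 0 else lennardJones r) :=
  fun Q _ _ hpd htail => template_neutrality Q hpd htail

end Summit.AtomisticToContinuum.Crystallization.Theorems.ThreeConeCertificateExactCertificate.Field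

end
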